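import Mathlib.Algebra.Lie.Weights.RootSystem
import HarnessLib

/-!
# Brackets of root vectors do not vanish: `[𝔤_α, 𝔤_γ] ≠ 0` when `α + γ` is a root

For a finite-dimensional Lie algebra `L` with non-degenerate Killing form over a field of
characteristic zero and a splitting Cartan subalgebra `H`: if `α`, `γ` are roots with `α + γ`
a root, then `⁅x, y⁆ ≠ 0` for all non-zero `x ∈ 𝔤_α`, `y ∈ 𝔤_γ`
(`lie_ne_zero_of_mem_rootSpace`; Humphreys, *Introduction to Lie Algebras*, §8.4 Prop. (d);
Bourbaki, *Lie* VIII §2.2). Proof: `y` spans `𝔤_γ`, which lies in the `α`-string through `γ`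
strictly below its top `δ = γ + q α` (`q ≥ 1`); a primitive vector `x_δ` of the `sl₂`-triple of
`α` generates the string, `f^q x_δ` spans `𝔤_γ`, and `e f^q x_δ = q (p + 1) f^{q-1} x_δ ≠ 0`
(Mathlib `IsSl2Triple.HasPrimitiveVectorWith.lie_e_pow_succ_toEnd_f`,
`pow_toEnd_f_ne_zero_of_eq_nat`). As a consequence such a Lie algebra is generated by `H` and
the root vectors of the simple roots of any base (used in
`Literature.NumberTheory.Automorphic.ChevalleySystem`). Everything is proved; [folklore].

## Mathlib

`LieAlgebra.IsKilling.exists_isSl2Triple_of_weight_isNonZero`, `chainTop`, `chainLength`,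
`rootSpace_zsmul_add_ne_bot_iff`, `finrank_rootSpace_eq_one`. Mathlib has the string but not
this non-vanishing statement.
-/

noncomputable section

open Module Set Function LieAlgebra LieModule LieAlgebra.IsKilling

namespace Literature.Algebra.Lie

variable {K L : Type*} [Field K] [CharZero K] [LieRing L] [LieAlgebra K L] [FiniteDimensional K L]
  {H : LieSubalgebra K L} [H.IsCartanSubalgebra] [IsKilling K L] [IsTriangularizable K H L]

/-- In a one-dimensional root space, a non-zero vector spans. [folklore] -/
lemma exists_smul_eq_of_mem_rootSpace {α : Weight K H L} (hα : α.IsNonZero) {x y : L}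
    (hx : x ∈ rootSpace H α) (hx0 : x ≠ 0) (hy : y ∈ rootSpace H α) : ∃ c : K, y = c • x := by
  have h1 : finrank K (rootSpace H α) = 1 := finrank_rootSpace_eq_one α hα
  have := (finrank_eq_one_iff_of_nonzero' (⟨x, hx⟩ : rootSpace H α)
    (fun h => hx0 (congrArg Subtype.val h))).1 h1 ⟨y, hy⟩
  obtain ⟨c, hc⟩ := this
  exact ⟨c, by simpa using congrArg Subtype.val hc.symm⟩

/-- **`[𝔤_α, 𝔤_γ] ≠ 0` when `α + γ` is a weight**: for non-zero roots `α`, `γ` with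
`rootSpace H (α + γ) ≠ ⊥` and non-zero `x ∈ 𝔤_α`, `y ∈ 𝔤_γ`, the bracket `⁅x, y⁆` is non-zero
(Humphreys §8.4 Prop. (d): `[𝔤_α, 𝔤_γ] = 𝔤_{α+γ}`). [folklore] -/
theorem lie_ne_zero_of_mem_rootSpace {α γ : Weight K H L} (hα : α.IsNonZero) (hγ : γ.IsNonZero)
    (hsum : rootSpace H (⇑α + ⇑γ) ≠ ⊥) {x y : L} (hx : x ∈ rootSpace H α) (hx0 : x ≠ 0)
    (hy : y ∈ rootSpace H γ) (hy0 : y ≠ 0) : ⁅x, y⁆ ≠ 0 := by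
  -- the `sl₂`-triple of `α` and a primitive vector at the top `δ` of the `α`-string through `γ`
  obtain ⟨h, e, f, ht, he, hf⟩ := exists_isSl2Triple_of_weight_isNonZero hα
  obtain rfl := ht.h_eq_coroot hα he hf
  obtain ⟨xt, hxt, hxt0⟩ := (chainTop α γ).exists_ne_zero
  have prim : ht.HasPrimitiveVectorWith xt (chainLength α γ : K) :=
    have := lie_mem_genWeightSpace_of_mem_genWeightSpace he hxt
    ⟨hxt0, (chainLength_smul _ _ hxt).symm, by rwa [genWeightSpace_add_chainTop _ _ hα] at this⟩
  -- `q = chainTopCoeff α γ ≥ 1` since `γ + α` is a root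
  set q := chainTopCoeff α γ with hq
  have hq1 : 1 ≤ q := by
    have := (rootSpace_zsmul_add_ne_bot_iff α γ hα 1).1 (by simpa using hsum)
    exact_mod_cast this.1
  obtain ⟨q', hq'⟩ : ∃ q', q = q' + 1 := ⟨q - 1, by omega⟩
  -- `f^q x_δ` spans `𝔤_γ`
  have hmem : ∀ n : ℕ, ((toEnd K L L f) ^ n) xt ∈ rootSpace H (-(n • ⇑α) + ⇑(chainTop α γ)) := by
    intro n
    have := toEnd_pow_apply_mem hf hxt n
    simpa only [smul_neg] using this
  have hγeq : (-(q • ⇑α) + ⇑(chainTop α γ) : H → K) = ⇑γ := by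
    rw [coe_chainTop', hq]; abel
  have hyq : ((toEnd K L L f) ^ q) xt ∈ rootSpace H γ := by
    have := hmem q; rwa [hγeq] at this
  have hyq0 : ((toEnd K L L f) ^ q) xt ≠ 0 :=
    prim.pow_toEnd_f_ne_zero_of_eq_nat rfl
      (by rw [← chainBotCoeff_add_chainTopCoeff]; exact Nat.le_add_left _ _)
  -- `e (f^q x_δ) = q (length - q + 1) f^{q-1} x_δ ≠ 0`
  have hey : ⁅e, ((toEnd K L L f) ^ q) xt⁆ ≠ 0 := by
    rw [hq', prim.lie_e_pow_succ_toEnd_f q']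
    refine smul_ne_zero ?_ (prim.pow_toEnd_f_ne_zero_of_eq_nat rfl ?_)
    · have h1 : (chainLength α γ : K) - q' ≠ 0 := by
        have : q' < chainLength α γ := by
          rw [← chainBotCoeff_add_chainTopCoeff]; omega
        intro h0
        have h2 : (chainLength α γ : K) = q' := sub_eq_zero.1 h0
        exact absurd (by exact_mod_cast h2 : chainLength α γ = q') (by omega)
      exact mul_ne_zero (by exact_mod_cast Nat.succ_ne_zero q') h1
    · rw [← chainBotCoeff_add_chainTopCoeff]; omega
  -- transport to `x = c e`, `y = d f^q x_δ`
  obtain ⟨c, rfl⟩ := exists_smul_eq_of_mem_rootSpace hα he ht.e_ne_zero hx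
  obtain ⟨d, rfl⟩ := exists_smul_eq_of_mem_rootSpace hγ hyq hyq0 hy
  have hc : c ≠ 0 := by rintro rfl; exact hx0 (zero_smul _ _)
  have hd : d ≠ 0 := by rintro rfl; exact hy0 (zero_smul _ _)
  rw [smul_lie, lie_smul]
  exact smul_ne_zero hc (smul_ne_zero hd hey)

end Literature.Algebra.Lie
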